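/-
Copyright (c) 2026 the pub-hodgecm-mathlib formalisation cell (harness21).  Prover seat hodgecm-mathlib-K2E3-p06 (g6) (E3 hand lent to strike line L1 by CHAIR K2-lead (g2) VALVE
WORD W4; LEAD F0P6-plan (g14) BATCH #106 (1) ∕ #108 (1) «U1 STAGE-3 BRICK B2a»), Track B «K2-LIT» ∕ hLiu418 = stmt-HodgeConjecture-24832: organ U1-CT-ind stage 3
(«U1-glob»), brick B2a of K2E3-p14 (g9)'s census `K2/K2E3-p14/g9/CENSUS-U1glob-Stage3.K2E3-p14-g9.md` — «THE RANK-ONE TOWER STEP», core (group-abstract, like ★ B3∕B6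
`K2LiuRankOneOperators`): AT THE CENTRE OF THE OUTER RANK-ONE STEP THE NORMALISED OPERATOR IS A SCALAR, SO ITS KERNEL IS TRIVIAL — (L-mult)+(L-N1) in the POLE CASE.
THEOREMS ONLY (no `def`, no `instance`, no notation, no named-fact hypothesis, no `sorry`).
-/
import Summits.HodgeConjecture.HodgeConjecture.Theorems.K2LiuRankOneOperators   -- ★ B3∕B6 (K2Liu-p09 (g5)): `integral_eq_lFactor_mul_normalised`, `isQRationalRegularAt_normalised`; ★ F1 `IsQRationalRegularAt`
import HarnessLib

/-!
# Crux `HLiu418`, organ U1-CT-ind STAGE 3 («U1-glob»), brick B2a (core): THE RANK-ONE TOWER STEP AT THE CENTRE — the normalised rank-one operator at the pole of its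
# `L`-factor is the scalar `C₀·(1 − q⁻¹)·μ(𝒪)`, hence injective; kernel transfer from the Siegel face `Fn(s₀) = 0` to the two-step (intermediate) family
# [GanTakeda2011SiegelWeil §7 p. 24 «`M_{m−1}(s−½)((M_{w₁}(s)Φ)|_{G_{m−1}}) = (M_m(s)Φ)|_{G_{m−1}}`», Lemma 7.4; Casselman1980 §3 Thm. 3.1; KudlaRallis1994 §2]

Cell `hodgecm-mathlib`, crux item hLiu418 = `stmt-HodgeConjecture-24832`; squad K2, strike line L1, LEAD F0P6-plan (g14); desk K2E3-p14 (g9) + K2Liu-p13 (g4);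
prover K2E3-p06 (g6).  Lane `--supports stmt-HodgeConjecture-24832 --as helper` (count-neutral).  DEF-FREE and GROUP-ABSTRACT: `G` is any group, `K_w` a completion
of a number field; the concrete doubled `H_v = U(2,2)(F_v)` enters only in the sequel B2a-inst (over ★ B4d-3 `K2LiuSiegelIntertwiningCocycle` and ★ B7
`K2LiuA7NormalisedRegularity`).

THE POINT (census §1–§2, K2E5-plan STAGE3-RECHECK §3 (L-mult)(L-N1)).  U1-glob needs, at the distinguished finite place `v`, the TOWER STEP: from the Siegel face
«the NORMALISED Siegel operator kills the local section at `s₀ = ½`» (★ (A4′-R) `Fn s₀ · = 0`) to «the normalised INTERMEDIATE (two-step) family vanishes at `s₀`»,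
which B2b then reads inside the rank-one singular Whittaker letter.  By ★ B4d-3 the Siegel integral of `U(2,2)_v` is the ITERATED rank-one integral `M = A₂ A₁ A₂` (the
Casselman cocycle along `w_Δ = w₂ w₁ w₂`), so (L-mult) «`M^{(1)}(s−½) ∘ i* ∘ M_{w₁ w₂}(s) = i* ∘ M_Δ(s)`» holds IN SUBSTANCE with the OUTER step `A₂` in the rôle of the
rank-one operator `M^{(1)}(s − ½)` (its Gindikin–Karpelevich factor is the third one, `L_F(2s−1, χ_F) = L(e(s) − 1, ν)` with `e(s) = 2s`, `ν = χ_{F,v}`), applied to the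
TWO-STEP family `G_s := A₁ A₂ f_s` — no restriction `i*` to `U(1,1)` is needed, and the conclusion is correspondingly STRONGER (vanishing on all of `H_v`).  (L-N1)
«`N^{(1)}(0)` is injective» is, in the POLE CASE `unramValue ν = 1` (e.g. `χ_F = 1`, ★ `unramValue_one`; then `L(e(s)−1, ν)` IS singular at `s₀`: the outer step sits at
its centre), a TRIVIALITY of ★ B3 §4's explicit normal form
  `N(s)(y) = (1 − unramValue ν · q^{−(e(s)−1)}) · Σ_{b∈R} μ(𝔭^m) G_s(w u(b) y) + C₀(s) G_s(y) (1 − q⁻¹) μ(𝒪) (unramValue ν · q^{1−e(s)})^{m+1}`: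
at `e(s₀) = 1` the HEAD factor `1 − unramValue ν · q⁰` VANISHES and the tail monomial is `1`, so **`N(s₀)(y) = C₀(s₀) · (1 − q⁻¹) · μ(𝒪) · G_{s₀}(y)`** — the normalised
operator at the centre is the SCALAR `C₀(s₀)(1 − q⁻¹)μ(𝒪)` (the local shadow of «the residue of the intertwining operator at its first pole is a multiple of the
identity»), injective as soon as `C₀(s₀) ≠ 0` (the coroot value of the inducing character, a unit).  So, in the pole case, `N(s₀)(y) = 0 ⟹ G_{s₀}(y) = 0` for EVERY
`y` (§2), and the `∃ Fn` of the Siegel face is tied to this explicit normal form by the IDENTITY PRINCIPLE of ★ F1 (§3: two presentations `I = A·Fn = A·(κ·N)` on a right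
half-plane with `Fn`, `κ·N` regular at `s₀` agree at `s₀`).
* §1 `normalised_at_centre` (any `ν`: at `e(s₀) = 1` the bracket is `(1 − unramValue ν)·HEAD + C₀ G (1−q⁻¹) μ(𝒪) (unramValue ν)^{m+1}`),
  **`normalised_eq_tail_of_centre`** (`unramValue ν = 1`: `= C₀(s₀) · G_{s₀}(y) · (1 − q⁻¹) · μ(𝒪)`).
* §2 **`apply_eq_zero_of_normalised_eq_zero`** — KERNEL TRANSFER, pole case: `N(s₀)(y) = 0`, `C₀(s₀) ≠ 0` ⟹ `G_{s₀}(y) = 0` (`q > 1`, `μ(𝒪) > 0`); `normalised_eq_zero_iff`.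
* §3 **`eq_at_of_two_presentations`** (identity principle for two factorisations through the same non-vanishing `A` on a half-plane), `eq_zero_iff_of_two_presentations`,
  and the assembled pole-case tower step **`apply_eq_zero_of_face_eq_zero`**: `Fn(s₀) = 0` for a face `I = A·Fn` and a cocycle presentation `I = A·(κ·N)` (`κ(s₀) ≠ 0`,
  everything regular at `s₀`, `A ≠ 0` on the half-plane) ⟹ `G_{s₀}(y) = 0`.
HONEST RESIDUAL (said, not typed): in the NON-POLE CASE (`ν` ramified, or unramified with `unramValue ν ≠ 1`) (L-N1) is the genuine rank-one normalised functional equation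
`N^{(1)}(−s₁) ∘ N^{(1)}(s₁) = 1` [GanTakeda2011SiegelWeil, Lemma 7.4], NOT in the tree; §1 `normalised_at_centre` is what that case starts from.
References: [GanTakeda2011SiegelWeil] W. T. Gan, S. Takeda, *On the regularized Siegel–Weil formula (the second term identity)* (2011), §7 pp. 23–24, Lemmas 7.3–7.4;
[Casselman1980] W. Casselman, Compositio Math. 40 (1980), §3 Thm. 3.1 (rank-one operators, the cocycle `T_w = Π T_α`, `c_α(χ)`); [KudlaRallis1994] S. Kudla, S. Rallis,
Ann. of Math. 140 (1994), §2; [KudlaSweet1997] S. Kudla, W. J. Sweet, Israel J. Math. 98 (1997), §1 (rationality in `q^{-s}`); [MoeglinWaldspurger1995] IV.1.9–IV.1.11.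
HONEST LABEL.  Count-neutral helper: `HC_CM` is proved only modulo the 7 printed citations (2 remaining named inputs: hLiu418 = `stmt-HodgeConjecture-24832`,
h413 = `stmt-HodgeConjecture-24833`) until rung 0 closes; U1-glob stays OPEN (bricks B2a-inst ∕ B2b ∕ B3 ∕ B4 ∕ B5); this file closes no socket.
-/

set_option autoImplicit false
set_option linter.dupNamespace false -- the mandated namespace repeats `HodgeConjecture.HodgeConjecture`

noncomputable section

open MeasureTheory Filter Topology Set Polynomial
open scoped NNReal ENNReal
open NumberField IsDedekindDomain
open Literature.NumberTheory.GaloisRepresentations.IsNonarchimedeanLocalField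
open Literature.NumberTheory.Automorphic Literature.NumberTheory.Automorphic.LocalFieldHaar
open Summit.HodgeConjecture.HodgeConjecture.Cruxes.HLiu418.K2LiuQRationalDefs
open Summit.HodgeConjecture.HodgeConjecture.Cruxes.HLiu418.K2LiuLocalLFactorDefs
open Summit.HodgeConjecture.HodgeConjecture.Cruxes.HLiu418.K2LiuQRationalLFactor
open Summit.HodgeConjecture.HodgeConjecture.Cruxes.HLiu418.K2LiuRankOneOperators

namespace Summit.HodgeConjecture.HodgeConjecture.Cruxes.HLiu418.K2LiuIntertwiningTowerRankOne

variable {K : Type} [Field K] [NumberField K] {w : HeightOneSpectrum (𝓞 K)} {G : Type*} [Group G]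

/-! ## §1 The normalised rank-one bracket at the centre of its step -/

section Centre

variable [MeasurableSpace (w.adicCompletion K)] (μ : Measure (w.adicCompletion K))

/-- **THE NORMALISED BRACKET AT THE CENTRE** (any `ν`): at a parameter `s₀` with `e(s₀) = a·s₀ + c = 1` the normalised value of ★ B3 §4 reads
`(1 − unramValue ν) · Σ_{b∈R} μ(𝔭^m) G_{s₀}(w u(b) y) + C₀(s₀) G_{s₀}(y) (1 − q⁻¹) μ(𝒪) · (unramValue ν)^{m+1}` (`q⁰ = 1` in both monomials).
[cite: Casselman1980, §3 Thm. 3.1] [cite: GanTakeda2011SiegelWeil, §7 Lemma 7.4] -/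
theorem normalised_at_centre (f : ℂ → G → ℂ) (u : w.adicCompletion K → G) (w₀ y : G)
    (ν : (w.adicCompletion K)ˣ →* ℂˣ) (a : ℕ) (c : ℂ) (C₀ : ℂ → ℂ) (m : ℕ) (R : Finset (w.adicCompletion K))
    {s₀ : ℂ} (hs₀ : (a : ℂ) * s₀ + c = 1) :
    (1 - unramValue K w ν * (residueFieldCard (w.adicCompletion K) : ℂ) ^ (-(((a : ℂ) * s₀ + c) - 1))) *
          (∑ b ∈ R, (μ.real (primePowBall (w.adicCompletion K) (m : ℤ)) : ℂ) * f s₀ (w₀ * u b * y)) +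
        C₀ s₀ * f s₀ y * (1 - (residueFieldCard (w.adicCompletion K) : ℂ)⁻¹) * μ.real (primePowBall (w.adicCompletion K) 0) *
          (unramValue K w ν * (residueFieldCard (w.adicCompletion K) : ℂ) ^ (1 - ((a : ℂ) * s₀ + c))) ^ (m + 1) =
      (1 - unramValue K w ν) * (∑ b ∈ R, (μ.real (primePowBall (w.adicCompletion K) (m : ℤ)) : ℂ) * f s₀ (w₀ * u b * y)) +
        C₀ s₀ * f s₀ y * (1 - (residueFieldCard (w.adicCompletion K) : ℂ)⁻¹) * μ.real (primePowBall (w.adicCompletion K) 0) *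
          unramValue K w ν ^ (m + 1) := by
  simp only [hs₀, sub_self, neg_zero, Complex.cpow_zero, mul_one]

/-- **AT THE CENTRE, IN THE POLE CASE, THE NORMALISED OPERATOR IS A SCALAR**: with `e(s₀) = 1` and `unramValue ν = 1` (so that `L(e(s) − 1, ν)` is singular at
`s₀`) the head factor `1 − unramValue ν · q⁰` vanishes and the normalised value is TAIL-ONLY,
`N(s₀)(y) = C₀(s₀) · G_{s₀}(y) · (1 − q⁻¹) · μ(𝒪)` — «`N^{(1)}(0) = C₀(1 − q⁻¹)μ(𝒪) · id`». [cite: GanTakeda2011SiegelWeil, §7 Lemma 7.4] [cite: Casselman1980, §3 Thm. 3.1]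
[cite: KudlaRallis1994, §2] -/
theorem normalised_eq_tail_of_centre (f : ℂ → G → ℂ) (u : w.adicCompletion K → G) (w₀ y : G)
    (ν : (w.adicCompletion K)ˣ →* ℂˣ) (a : ℕ) (c : ℂ) (C₀ : ℂ → ℂ) (m : ℕ) (R : Finset (w.adicCompletion K))
    {s₀ : ℂ} (hs₀ : (a : ℂ) * s₀ + c = 1) (hν1 : unramValue K w ν = 1) :
    (1 - unramValue K w ν * (residueFieldCard (w.adicCompletion K) : ℂ) ^ (-(((a : ℂ) * s₀ + c) - 1))) *
          (∑ b ∈ R, (μ.real (primePowBall (w.adicCompletion K) (m : ℤ)) : ℂ) * f s₀ (w₀ * u b * y)) +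
        C₀ s₀ * f s₀ y * (1 - (residueFieldCard (w.adicCompletion K) : ℂ)⁻¹) * μ.real (primePowBall (w.adicCompletion K) 0) *
          (unramValue K w ν * (residueFieldCard (w.adicCompletion K) : ℂ) ^ (1 - ((a : ℂ) * s₀ + c))) ^ (m + 1) =
      C₀ s₀ * f s₀ y * (1 - (residueFieldCard (w.adicCompletion K) : ℂ)⁻¹) * μ.real (primePowBall (w.adicCompletion K) 0) := by
  rw [normalised_at_centre μ f u w₀ y ν a c C₀ m R hs₀, hν1, sub_self, zero_mul, zero_add, one_pow, mul_one]

end Centre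

/-! ## §2 Kernel transfer at the centre (pole case): `N(s₀)(y) = 0 ⟹ G_{s₀}(y) = 0` -/

section Kernel

variable [MeasurableSpace (w.adicCompletion K)] (μ : Measure (w.adicCompletion K)) [μ.IsAddHaarMeasure]

/-- the two universal scalars of the tail are non-zero: `1 − q⁻¹ ≠ 0` (`q > 1`) and `μ(𝒪) ≠ 0` (Haar). [folklore] -/
theorem one_sub_inv_mul_measureReal_ne_zero :
    (1 - (residueFieldCard (w.adicCompletion K) : ℂ)⁻¹) * (μ.real (primePowBall (w.adicCompletion K) 0) : ℂ) ≠ 0 := by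
  refine mul_ne_zero ?_ ?_
  · have hq : (1 : ℝ) < (residueFieldCard (w.adicCompletion K) : ℂ).re := by
      rw [Complex.natCast_re]
      exact_mod_cast one_lt_residueFieldCard (w.adicCompletion K)
    intro h
    have h1 : (residueFieldCard (w.adicCompletion K) : ℂ)⁻¹ = 1 := (sub_eq_zero.1 h).symm
    have h2 : (residueFieldCard (w.adicCompletion K) : ℂ) = 1 := inv_eq_one.1 h1
    rw [h2, Complex.one_re] at hq
    exact lt_irrefl _ hq
  · exact_mod_cast (measureReal_primePowBall_pos μ 0).ne'

/-- **KERNEL TRANSFER AT THE CENTRE (pole case)** — the tower step's (L-N1) in the only form U1-glob needs: if the normalised rank-one value of the family `G` at the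
centre `s₀` (`e(s₀) = 1`, `unramValue ν = 1`) vanishes at `y`, and the coroot value `C₀(s₀) ≠ 0`, then `G_{s₀}(y) = 0`.  (In the tower: `G` = the two-step family
`A₁ A₂ f`, the outer step = `M^{(1)}(s − ½)` at `s = ½`; «`N^{(1)}(0)` injective».) [cite: GanTakeda2011SiegelWeil, §7 p. 24, Lemma 7.4] [cite: Casselman1980, §3 Thm. 3.1] -/
theorem apply_eq_zero_of_normalised_eq_zero (f : ℂ → G → ℂ) (u : w.adicCompletion K → G) (w₀ y : G)
    (ν : (w.adicCompletion K)ˣ →* ℂˣ) (a : ℕ) (c : ℂ) (C₀ : ℂ → ℂ) (m : ℕ) (R : Finset (w.adicCompletion K))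
    {s₀ : ℂ} (hs₀ : (a : ℂ) * s₀ + c = 1) (hν1 : unramValue K w ν = 1) (hC₀ : C₀ s₀ ≠ 0)
    (h0 : (1 - unramValue K w ν * (residueFieldCard (w.adicCompletion K) : ℂ) ^ (-(((a : ℂ) * s₀ + c) - 1))) *
          (∑ b ∈ R, (μ.real (primePowBall (w.adicCompletion K) (m : ℤ)) : ℂ) * f s₀ (w₀ * u b * y)) +
        C₀ s₀ * f s₀ y * (1 - (residueFieldCard (w.adicCompletion K) : ℂ)⁻¹) * μ.real (primePowBall (w.adicCompletion K) 0) *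
          (unramValue K w ν * (residueFieldCard (w.adicCompletion K) : ℂ) ^ (1 - ((a : ℂ) * s₀ + c))) ^ (m + 1) = 0) :
    f s₀ y = 0 := by
  rw [normalised_eq_tail_of_centre μ f u w₀ y ν a c C₀ m R hs₀ hν1, mul_assoc (C₀ s₀ * f s₀ y)] at h0
  rcases mul_eq_zero.1 h0 with h | h
  · exact (mul_eq_zero.1 h).resolve_left hC₀
  · exact absurd h (one_sub_inv_mul_measureReal_ne_zero μ)

/-- **… and conversely** (pole case): `N(s₀)(y) = 0 ↔ G_{s₀}(y) = 0` when `C₀(s₀) ≠ 0`. [cite: GanTakeda2011SiegelWeil, §7 Lemma 7.4] [cite: Casselman1980, §3 Thm. 3.1] -/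
theorem normalised_eq_zero_iff (f : ℂ → G → ℂ) (u : w.adicCompletion K → G) (w₀ y : G)
    (ν : (w.adicCompletion K)ˣ →* ℂˣ) (a : ℕ) (c : ℂ) (C₀ : ℂ → ℂ) (m : ℕ) (R : Finset (w.adicCompletion K))
    {s₀ : ℂ} (hs₀ : (a : ℂ) * s₀ + c = 1) (hν1 : unramValue K w ν = 1) (hC₀ : C₀ s₀ ≠ 0) :
    (1 - unramValue K w ν * (residueFieldCard (w.adicCompletion K) : ℂ) ^ (-(((a : ℂ) * s₀ + c) - 1))) *
          (∑ b ∈ R, (μ.real (primePowBall (w.adicCompletion K) (m : ℤ)) : ℂ) * f s₀ (w₀ * u b * y)) +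
        C₀ s₀ * f s₀ y * (1 - (residueFieldCard (w.adicCompletion K) : ℂ)⁻¹) * μ.real (primePowBall (w.adicCompletion K) 0) *
          (unramValue K w ν * (residueFieldCard (w.adicCompletion K) : ℂ) ^ (1 - ((a : ℂ) * s₀ + c))) ^ (m + 1) = 0 ↔
      f s₀ y = 0 := by
  refine ⟨apply_eq_zero_of_normalised_eq_zero μ f u w₀ y ν a c C₀ m R hs₀ hν1 hC₀, fun h => ?_⟩
  rw [normalised_eq_tail_of_centre μ f u w₀ y ν a c C₀ m R hs₀ hν1, h, mul_zero, zero_mul, zero_mul]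

end Kernel

/-! ## §3 The identity principle ties the Siegel face `∃ Fn` to the explicit normal form; the assembled tower step -/

section Presentations

/-- **TWO PRESENTATIONS THROUGH THE SAME NON-VANISHING FACTOR AGREE AT `s₀`**: if `I = A·Fn = A·G′` on a right half-plane `a < re s` where `A ≠ 0`, with `Fn` and `G′`
rational in `q^{-s}` and regular at `s₀` (`q ≥ 2`), then `Fn(s₀) = G′(s₀)` (★ F1 `eq_of_eqOn_halfPlane`).  This is how the `∃ Fn` of the (A4′-R) face is identified with the
cocycle's explicit normal form at `½`. [cite: KudlaSweet1997, §1] [cite: Casselman1980, §3] -/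
theorem eq_at_of_two_presentations {q : ℕ} (hq : 2 ≤ q) {s₀ : ℂ} (a : ℝ) {I A Fn G' : ℂ → ℂ}
    (hFn : IsQRationalRegularAt q s₀ Fn) (hG' : IsQRationalRegularAt q s₀ G') (hA : ∀ s : ℂ, a < s.re → A s ≠ 0)
    (h₁ : ∀ s : ℂ, a < s.re → I s = A s * Fn s) (h₂ : ∀ s : ℂ, a < s.re → I s = A s * G' s) : Fn s₀ = G' s₀ :=
  hFn.eq_of_eqOn_halfPlane hq hG' a fun s hs => mul_left_cancel₀ (hA s hs) ((h₁ s hs).symm.trans (h₂ s hs))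

/-- hence `Fn(s₀) = 0 ↔ G′(s₀) = 0` for two such presentations. [cite: KudlaSweet1997, §1] -/
theorem eq_zero_iff_of_two_presentations {q : ℕ} (hq : 2 ≤ q) {s₀ : ℂ} (a : ℝ) {I A Fn G' : ℂ → ℂ}
    (hFn : IsQRationalRegularAt q s₀ Fn) (hG' : IsQRationalRegularAt q s₀ G') (hA : ∀ s : ℂ, a < s.re → A s ≠ 0)
    (h₁ : ∀ s : ℂ, a < s.re → I s = A s * Fn s) (h₂ : ∀ s : ℂ, a < s.re → I s = A s * G' s) : Fn s₀ = 0 ↔ G' s₀ = 0 := by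
  rw [eq_at_of_two_presentations hq a hFn hG' hA h₁ h₂]

/-- with a regular non-vanishing scalar `κ` in the second presentation, `I = A·(κ·N)`: `Fn(s₀) = 0 ↔ N(s₀) = 0`. [cite: KudlaSweet1997, §1] [cite: Casselman1980, §3] -/
theorem eq_zero_iff_of_presentation_mul {q : ℕ} (hq : 2 ≤ q) {s₀ : ℂ} (a : ℝ) {I A Fn κ N : ℂ → ℂ}
    (hFn : IsQRationalRegularAt q s₀ Fn) (hκ : IsQRationalRegularAt q s₀ κ) (hκ0 : κ s₀ ≠ 0) (hN : IsQRationalRegularAt q s₀ N)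
    (hA : ∀ s : ℂ, a < s.re → A s ≠ 0)
    (h₁ : ∀ s : ℂ, a < s.re → I s = A s * Fn s) (h₂ : ∀ s : ℂ, a < s.re → I s = A s * (κ s * N s)) : Fn s₀ = 0 ↔ N s₀ = 0 := by
  rw [eq_zero_iff_of_two_presentations hq a hFn (hκ.mul hN) hA h₁ h₂]
  exact ⟨fun h => (mul_eq_zero.1 h).resolve_left hκ0, fun h => by rw [h, mul_zero]⟩

variable [MeasurableSpace (w.adicCompletion K)] (μ : Measure (w.adicCompletion K)) [μ.IsAddHaarMeasure]

/-- **THE TOWER STEP AT THE CENTRE, POLE CASE, ASSEMBLED** («`Fn(s₀) · = 0 ⟹ G_{s₀} ≡ 0`», pointwise in `y`): let `I(s)` (the Siegel intertwining value at `y` along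
the family) have the FACE presentation `I = A·Fn` (★ (A4′-R): `A = aNorm`, `Fn` rational-regular at `s₀`) and the COCYCLE presentation `I = A·(κ·N)` on a right
half-plane `a′ < re s` where `A ≠ 0`, with `κ` regular and non-zero at `s₀` (Levi shift · Haar constant · the inner `L`-bookkeeping) and `N` the normalised rank-one bracket
of ★ B3 §4 over the two-step family `G` at `y` (`e(s) = a·s + c` regular data `C₀`, `G_s(y)`, `G_s(w u(b) y)`, `b ∈ R`); suppose the outer step sits at its centre,
`e(s₀) = 1`, in the pole case `unramValue ν = 1`, with coroot value `C₀(s₀) ≠ 0`.  Then `Fn(s₀) = 0 ⟹ G_{s₀}(y) = 0` — (L-mult)+(L-N1) of the census, no restriction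
to `U(1,1)` needed. [cite: GanTakeda2011SiegelWeil, §7 p. 24, Lemma 7.4] [cite: Casselman1980, §3 Thm. 3.1] [cite: KudlaRallis1994, §2] [cite: KudlaSweet1997, §1] -/
theorem apply_eq_zero_of_face_eq_zero (f : ℂ → G → ℂ) (u : w.adicCompletion K → G) (w₀ y : G)
    (ν : (w.adicCompletion K)ˣ →* ℂˣ) (a : ℕ) (c : ℂ) (C₀ : ℂ → ℂ) (m : ℕ) (R : Finset (w.adicCompletion K))
    {s₀ : ℂ} (hs₀ : (a : ℂ) * s₀ + c = 1) (hν1 : unramValue K w ν = 1) (hC₀0 : C₀ s₀ ≠ 0)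
    (hN : IsQRationalRegularAt (residueFieldCard (w.adicCompletion K)) s₀ fun s =>
      (1 - unramValue K w ν * (residueFieldCard (w.adicCompletion K) : ℂ) ^ (-(((a : ℂ) * s + c) - 1))) *
          (∑ b ∈ R, (μ.real (primePowBall (w.adicCompletion K) (m : ℤ)) : ℂ) * f s (w₀ * u b * y)) +
        C₀ s * f s y * (1 - (residueFieldCard (w.adicCompletion K) : ℂ)⁻¹) * μ.real (primePowBall (w.adicCompletion K) 0) *
          (unramValue K w ν * (residueFieldCard (w.adicCompletion K) : ℂ) ^ (1 - ((a : ℂ) * s + c))) ^ (m + 1))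
    (a' : ℝ) {I A Fn κ : ℂ → ℂ} (hFn : IsQRationalRegularAt (residueFieldCard (w.adicCompletion K)) s₀ Fn)
    (hκ : IsQRationalRegularAt (residueFieldCard (w.adicCompletion K)) s₀ κ) (hκ0 : κ s₀ ≠ 0) (hA : ∀ s : ℂ, a' < s.re → A s ≠ 0)
    (h₁ : ∀ s : ℂ, a' < s.re → I s = A s * Fn s)
    (h₂ : ∀ s : ℂ, a' < s.re → I s = A s * (κ s *
      ((1 - unramValue K w ν * (residueFieldCard (w.adicCompletion K) : ℂ) ^ (-(((a : ℂ) * s + c) - 1))) *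
          (∑ b ∈ R, (μ.real (primePowBall (w.adicCompletion K) (m : ℤ)) : ℂ) * f s (w₀ * u b * y)) +
        C₀ s * f s y * (1 - (residueFieldCard (w.adicCompletion K) : ℂ)⁻¹) * μ.real (primePowBall (w.adicCompletion K) 0) *
          (unramValue K w ν * (residueFieldCard (w.adicCompletion K) : ℂ) ^ (1 - ((a : ℂ) * s + c))) ^ (m + 1))))
    (hFn0 : Fn s₀ = 0) : f s₀ y = 0 := by
  have hq : 2 ≤ residueFieldCard (w.adicCompletion K) := one_lt_residueFieldCard (w.adicCompletion K)
  have hN0 := (eq_zero_iff_of_presentation_mul hq a' hFn hκ hκ0 hN hA h₁ h₂).1 hFn0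
  exact apply_eq_zero_of_normalised_eq_zero μ f u w₀ y ν a c C₀ m R hs₀ hν1 hC₀0 hN0

/-- **regularity of the bracket at the centre is automatic** from ★ B3 §4 `isQRationalRegularAt_normalised` when `s₀ = ½` and the data `C₀`, `G_·(y)`, `G_·(w u(b) y)` are regular
at `½` — the form in which B2a-inst supplies `hN` (the outer step of the `U(2,2)_v` cocycle has `e(s) = 2s`, centre `½`). [cite: KudlaSweet1997, §1] [cite: Casselman1980, §3] -/
theorem apply_half_eq_zero_of_face_eq_zero (f : ℂ → G → ℂ) (u : w.adicCompletion K → G) (w₀ y : G)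
    (ν : (w.adicCompletion K)ˣ →* ℂˣ) (a : ℕ) (c : ℂ) (C₀ : ℂ → ℂ) (m : ℕ) (R : Finset (w.adicCompletion K))
    (hs₀ : (a : ℂ) * (1 / 2) + c = 1) (hν1 : unramValue K w ν = 1) (hC₀0 : C₀ (1 / 2) ≠ 0)
    (hC₀ : IsQRationalRegularAt (residueFieldCard (w.adicCompletion K)) (1 / 2) C₀)
    (hfy : IsQRationalRegularAt (residueFieldCard (w.adicCompletion K)) (1 / 2) fun s => f s y)
    (hfR : ∀ b ∈ R, IsQRationalRegularAt (residueFieldCard (w.adicCompletion K)) (1 / 2) fun s => f s (w₀ * u b * y))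
    (a' : ℝ) {I A Fn κ : ℂ → ℂ} (hFn : IsQRationalRegularAt (residueFieldCard (w.adicCompletion K)) (1 / 2) Fn)
    (hκ : IsQRationalRegularAt (residueFieldCard (w.adicCompletion K)) (1 / 2) κ) (hκ0 : κ (1 / 2) ≠ 0) (hA : ∀ s : ℂ, a' < s.re → A s ≠ 0)
    (h₁ : ∀ s : ℂ, a' < s.re → I s = A s * Fn s)
    (h₂ : ∀ s : ℂ, a' < s.re → I s = A s * (κ s *
      ((1 - unramValue K w ν * (residueFieldCard (w.adicCompletion K) : ℂ) ^ (-(((a : ℂ) * s + c) - 1))) *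
          (∑ b ∈ R, (μ.real (primePowBall (w.adicCompletion K) (m : ℤ)) : ℂ) * f s (w₀ * u b * y)) +
        C₀ s * f s y * (1 - (residueFieldCard (w.adicCompletion K) : ℂ)⁻¹) * μ.real (primePowBall (w.adicCompletion K) 0) *
          (unramValue K w ν * (residueFieldCard (w.adicCompletion K) : ℂ) ^ (1 - ((a : ℂ) * s + c))) ^ (m + 1))))
    (hFn0 : Fn (1 / 2) = 0) : f (1 / 2) y = 0 :=
  apply_eq_zero_of_face_eq_zero μ f u w₀ y ν a c C₀ m R hs₀ hν1 hC₀0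
    (isQRationalRegularAt_normalised μ f w₀ y ν a c C₀ m R hC₀ hfy hfR) a' hFn hκ hκ0 hA h₁ h₂ hFn0

end Presentations

end Summit.HodgeConjecture.HodgeConjecture.Cruxes.HLiu418.K2LiuIntertwiningTowerRankOne

end
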